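import Summits.ValiantsHypothesis.ValiantsHypothesis.Theorems.SymPencilPerFourPermOrthThree

/-!
# Route `SymPencil` — three-dimensional spaces with vanishing `2 × 2` subpermanents lie in one row
# or one column (the small-kernel cells `(13, 3, ·)` of sizes `27, 28`, and a primitive for the
# `6`-dimensional residual `R6`; `--supports` stmt-ValiantsHypothesis-5674 `SdcSuperquadratic`)

**Theorem** (`row_or_col_of_perm_two_blocks_three`).  Over a field of characteristic `0`, a
`3`-dimensional linear space `W` of `4 × 4` matrices on which all `2 × 2` subpermanents vanish is
contained in a single row or in a single column.  (Dimension `4`: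
`SymPencilPerFourBlocksEq.row_or_col_of_perm_two_blocks`, val-width-5676-p2 g3; dimension `≤ 4`
always: `SymPencilPerFourBlocks.finrank_le_four_of_perm_two_blocks`, val-width-5674-p2.  In
dimension `2` the statement fails: `span{E₀₀ + E₀₁, E₁₀ - E₁₁}`.)

Proof.  If some row `q` maps `W` onto a `3`-dimensional space (`rows_eq_zero_of_row_three`): for
rows `q, p` and distinct columns `j, l, m` the three subpermanent relations give
`x_{ql} x_{qm} x_{pj} = 0` pointwise on `W`; a product of linear forms vanishing on `W` has a
factor vanishing on `W` (`SymPencilPerFourPairingHyperplane.exists_forall_eq_zero_of_prod_eq_zero`),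
and at most one coordinate of row `q` can vanish identically (rank `3`), so `x_{pj} ≡ 0`: `W` lies
in row `q`.  Otherwise run the row flag of `finrank_le_four_of_perm_two_blocks`: the level
dimensions are `≤ 1` (a level of dimension `≥ 2` forces all others to be `0`, total `< 3`, or is a
rank-`3` row), so three levels carry non-zero vectors, pairwise perm-orthogonal across levels; three
pairwise perm-orthogonal non-zero vectors of `K⁴` have a common one-point support `{c}`
(`common_support_of_perm_orth_three`), and then each level representative, hence `W`, lies in
column `c`.

Use: a kernel of dimension `3` with defect `≤ 3` (cells `(13, 3, ·)` at `m = 27, 28`) has all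
`2 × 2` subpermanents vanishing, so it lies in a row or column and `per_4` is affine along it.
Honest framing: linear algebra; window `25 ≤ sdc(per₄) ≤ 29`; the crux `SdcSuperquadratic` and
`VP ≠ VNP` are untouched.  No definitions, no named facts. [folklore]
-/

noncomputable section

-- single-conjunct layout: Sub = Summit, duplicated namespace component intended
set_option linter.dupNamespace false

namespace Summit.ValiantsHypothesis.ValiantsHypothesis.Theorems.SymPencilPerFourBlocksThree

open Matrix Finset Module
open Literature.Computability.AlgebraicComplexity.AlperBogartVelasco
open Summit.ValiantsHypothesis.ValiantsHypothesis.Theorems.SymPencilPerFourPairingHyperplane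
open Summit.ValiantsHypothesis.ValiantsHypothesis.Theorems.SymPencilPerFourPermOrthThree

variable {K : Type*} [Field K]

/-- **Three-dimensional spaces with vanishing `2 × 2` subpermanents lie in one row or one column.**
See the module docstring. [folklore] -/
theorem row_or_col_of_perm_two_blocks_three [CharZero K] (W : Submodule K (Fin 4 × Fin 4 → K))
    (hB : ∀ y ∈ W, ∀ i k j l : Fin 4, i ≠ k → j ≠ l →
      y (i, j) * y (k, l) + y (i, l) * y (k, j) = 0)
    (h3 : finrank K W = 3) :
    (∃ q : Fin 4, ∀ x ∈ W, ∀ i j : Fin 4, i ≠ q → x (i, j) = 0) ∨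
    (∃ c : Fin 4, ∀ x ∈ W, ∀ i j : Fin 4, j ≠ c → x (i, j) = 0) := by
  classical
  -- rows as linear maps and the flag (as in `finrank_le_four_of_perm_two_blocks`)
  let ρ : Fin 4 → (Fin 4 × Fin 4 → K) →ₗ[K] (Fin 4 → K) :=
    fun r => LinearMap.funLeft K K fun j => (r, j)
  have hρ : ∀ r x j, ρ r x j = x (r, j) := fun _ _ _ => rfl
  -- Case A: a row of rank `3`
  by_cases hA : ∃ q : Fin 4, 3 ≤ finrank K ↥(W.map (ρ q))
  · obtain ⟨q, hq⟩ := hA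
    exact Or.inl ⟨q, fun x hx i j hiq => rows_eq_zero_of_row_three W hB q hq x hx i hiq j⟩
  push Not at hA
  right
  let V₂ : Submodule K (Fin 4 × Fin 4 → K) := W ⊓ LinearMap.ker (ρ 3)
  let V₁ : Submodule K (Fin 4 × Fin 4 → K) := V₂ ⊓ LinearMap.ker (ρ 2)
  let V₀ : Submodule K (Fin 4 × Fin 4 → K) := V₁ ⊓ LinearMap.ker (ρ 1)
  let V : Fin 4 → Submodule K (Fin 4 × Fin 4 → K) := ![V₀, V₁, V₂, W]
  have hV0 : V 0 = V₀ := rfl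
  have hV1 : V 1 = V₁ := rfl
  have hV2 : V 2 = V₂ := rfl
  have hV3 : V 3 = W := rfl
  have hcases : ∀ i : Fin 4, i = 0 ∨ i = 1 ∨ i = 2 ∨ i = 3 := by decide
  have memV : ∀ p, ∀ x ∈ V p, x ∈ W ∧ ∀ r, p < r → ∀ j, x (r, j) = 0 := by
    intro p x hx
    rcases hcases p with rfl | rfl | rfl | rfl
    · rw [hV0] at hx
      simp only [V₀, V₁, V₂, Submodule.mem_inf, LinearMap.mem_ker] at hx
      obtain ⟨⟨⟨hW', h3'⟩, h2⟩, h1⟩ := hx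
      refine ⟨hW', fun r hr j => ?_⟩
      rcases hcases r with rfl | rfl | rfl | rfl
      · exact absurd hr (by decide)
      · exact congr_fun h1 j
      · exact congr_fun h2 j
      · exact congr_fun h3' j
    · rw [hV1] at hx
      simp only [V₁, V₂, Submodule.mem_inf, LinearMap.mem_ker] at hx
      obtain ⟨⟨hW', h3'⟩, h2⟩ := hx
      refine ⟨hW', fun r hr j => ?_⟩
      rcases hcases r with rfl | rfl | rfl | rfl
      · exact absurd hr (by decide)
      · exact absurd hr (by decide)
      · exact congr_fun h2 j
      · exact congr_fun h3' j
    · rw [hV2] at hx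
      simp only [V₂, Submodule.mem_inf, LinearMap.mem_ker] at hx
      obtain ⟨hW', h3'⟩ := hx
      refine ⟨hW', fun r hr j => ?_⟩
      rcases hcases r with rfl | rfl | rfl | rfl
      · exact absurd hr (by decide)
      · exact absurd hr (by decide)
      · exact absurd hr (by decide)
      · exact congr_fun h3' j
    · rw [hV3] at hx
      refine ⟨hx, fun r hr j => ?_⟩
      exact absurd (Fin.le_last r) (not_le.2 hr)
  have hVle : ∀ p, V p ≤ W := fun p x hx => (memV p x hx).1
  -- dimension count along the flag
  have hdim : finrank K W = ∑ p, finrank K ((V p).map (ρ p)) := by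
    have hbot : (V₀ ⊓ LinearMap.ker (ρ 0) : Submodule K _) = ⊥ := by
      rw [eq_bot_iff]
      intro x hx
      rw [Submodule.mem_inf, LinearMap.mem_ker] at hx
      obtain ⟨-, hrows⟩ := memV 0 x hx.1
      have h0 : ∀ j, x (0, j) = 0 := fun j => congr_fun hx.2 j
      rw [Submodule.mem_bot]
      funext ⟨i, j⟩
      by_cases hi : i = 0
      · subst hi; exact h0 j
      · exact hrows i (by
          have : (0 : Fin 4) ≤ i := Fin.zero_le i
          exact lt_of_le_of_ne this (Ne.symm hi)) j
    rw [Fin.sum_univ_four, hV0, hV1, hV2, hV3,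
      finrank_eq_finrank_map_add_finrank_inf_ker W (ρ 3),
      finrank_eq_finrank_map_add_finrank_inf_ker V₂ (ρ 2),
      finrank_eq_finrank_map_add_finrank_inf_ker V₁ (ρ 1),
      finrank_eq_finrank_map_add_finrank_inf_ker V₀ (ρ 0), hbot, finrank_bot]
    ring
  -- the pairing between two levels
  have hpair : ∀ (p q : Fin 4) (x x' : Fin 4 × Fin 4 → K), x ∈ W → x' ∈ W →
      (∀ j, x (q, j) = 0) → ∀ j l, j ≠ l → p ≠ q →
      x (p, j) * x' (q, l) + x (p, l) * x' (q, j) = 0 := by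
    intro p q x x' hx hx' hxq j l hjl hpq
    have h1 := hB (x + x') (W.add_mem hx hx') p q j l hpq hjl
    have h2 := hB x' hx' p q j l hpq hjl
    simp only [Pi.add_apply, hxq, zero_add] at h1
    linear_combination h1 - h2
  have hP : ∀ p q, p ≠ q → ∀ u ∈ (V p).map (ρ p), ∀ v ∈ (V q).map (ρ q),
      ∀ j l, j ≠ l → u j * v l + u l * v j = 0 := by
    intro p q hpq u hu v hv j l hjl
    rw [Submodule.mem_map] at hu hv
    obtain ⟨x, hx, rfl⟩ := hu
    obtain ⟨x', hx', rfl⟩ := hv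
    obtain ⟨hxW, hxr⟩ := memV p x hx
    obtain ⟨hx'W, hx'r⟩ := memV q x' hx'
    simp only [hρ]
    rcases lt_or_gt_of_ne hpq with hlt | hgt
    · exact hpair p q x x' hxW hx'W (hxr q hlt) j l hjl hpq
    · have h := hpair q p x' x hx'W hxW (hx'r p hgt) l j hjl.symm hpq.symm
      linear_combination h
  -- every level has dimension `≤ 1`: a level of dimension `≥ 2` kills the others, total `< 3`
  have hle2 : ∀ p, finrank K ((V p).map (ρ p)) ≤ 2 := fun p =>
    (Submodule.finrank_mono (Submodule.map_mono (hVle p))).trans (Nat.le_of_lt_succ (hA p))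
  have hPL : ∀ p q, p ≠ q → 1 ≤ finrank K ((V q).map (ρ q)) →
      finrank K ((V p).map (ρ p)) ≤ 1 := by
    intro p q hpq hq
    have hne : (V q).map (ρ q) ≠ ⊥ := fun h => by
      rw [h, finrank_bot] at hq; exact absurd hq (by decide)
    obtain ⟨v, hv, hv0⟩ := Submodule.exists_mem_ne_zero_of_ne_bot hne
    obtain ⟨c₀, hc₀⟩ : ∃ c₀, v c₀ ≠ 0 := by
      by_contra hall
      push Not at hall
      exact hv0 (funext hall)
    refine finrank_le_one_of_pairings _ v hc₀ fun u hu j hj => ?_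
    exact hP p q hpq u hu v hv c₀ j (Ne.symm hj)
  have hle1 : ∀ p, finrank K ((V p).map (ρ p)) ≤ 1 := by
    intro p
    by_contra hp
    push Not at hp
    have hz : ∀ p', p' ≠ p → finrank K ((V p').map (ρ p')) = 0 := by
      intro p' hp'
      by_contra hne
      have h1 : 1 ≤ finrank K ((V p').map (ρ p')) := Nat.one_le_iff_ne_zero.2 hne
      have := hPL p p' hp'.symm h1
      omega
    have hsum := hdim
    rw [h3, Fin.sum_univ_four] at hsum
    have h2p := hle2 p
    rcases hcases p with rfl | rfl | rfl | rfl
    · rw [hz 1 (by decide), hz 2 (by decide), hz 3 (by decide)] at hsum; omega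
    · rw [hz 0 (by decide), hz 2 (by decide), hz 3 (by decide)] at hsum; omega
    · rw [hz 0 (by decide), hz 1 (by decide), hz 3 (by decide)] at hsum; omega
    · rw [hz 0 (by decide), hz 1 (by decide), hz 2 (by decide)] at hsum; omega
  -- hence exactly three levels of dimension `1`: pick the level `p₀` of dimension `0`
  have hsum : ∑ p, finrank K ((V p).map (ρ p)) = 3 := by rw [← hdim, h3]
  -- non-zero representatives of the non-zero levels
  have hrep : ∀ p, finrank K ((V p).map (ρ p)) = 1 →
      ∃ x ∈ V p, ρ p x ≠ 0 := by
    intro p hp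
    have hne : (V p).map (ρ p) ≠ ⊥ := fun h => by rw [h, finrank_bot] at hp; exact absurd hp (by decide)
    obtain ⟨v, hv, hv0⟩ := Submodule.exists_mem_ne_zero_of_ne_bot hne
    obtain ⟨x, hx, rfl⟩ := hv
    exact ⟨x, hx, hv0⟩
  -- the three non-zero levels
  obtain ⟨p₀, hp₀, hothers⟩ : ∃ p₀ : Fin 4, finrank K ((V p₀).map (ρ p₀)) = 0 ∧
      ∀ p, p ≠ p₀ → finrank K ((V p).map (ρ p)) = 1 := by
    rw [Fin.sum_univ_four] at hsum
    have a0 := hle1 0; have a1 := hle1 1; have a2 := hle1 2; have a3 := hle1 3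
    rcases Nat.eq_zero_or_pos (finrank K ((V 0).map (ρ 0))) with h0 | h0
    · refine ⟨0, h0, fun p hp => ?_⟩
      rcases hcases p with rfl | rfl | rfl | rfl
      · exact absurd rfl hp
      all_goals omega
    rcases Nat.eq_zero_or_pos (finrank K ((V 1).map (ρ 1))) with h1 | h1
    · refine ⟨1, h1, fun p hp => ?_⟩
      rcases hcases p with rfl | rfl | rfl | rfl
      · omega
      · exact absurd rfl hp
      all_goals omega
    rcases Nat.eq_zero_or_pos (finrank K ((V 2).map (ρ 2))) with h2 | h2
    · refine ⟨2, h2, fun p hp => ?_⟩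
      rcases hcases p with rfl | rfl | rfl | rfl
      · omega
      · omega
      · exact absurd rfl hp
      · omega
    · refine ⟨3, by omega, fun p hp => ?_⟩
      rcases hcases p with rfl | rfl | rfl | rfl
      all_goals omega
  -- three distinct indices `≠ p₀`
  obtain ⟨p₁, p₂, p₃, h10, h20, h30, h12, h13, h23, hcov⟩ :
      ∃ p₁ p₂ p₃ : Fin 4, p₁ ≠ p₀ ∧ p₂ ≠ p₀ ∧ p₃ ≠ p₀ ∧ p₁ ≠ p₂ ∧ p₁ ≠ p₃ ∧ p₂ ≠ p₃ ∧
        ∀ p : Fin 4, p = p₀ ∨ p = p₁ ∨ p = p₂ ∨ p = p₃ := by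
    have key : ∀ p₀ : Fin 4, ∃ p₁ p₂ p₃ : Fin 4, p₁ ≠ p₀ ∧ p₂ ≠ p₀ ∧ p₃ ≠ p₀ ∧ p₁ ≠ p₂ ∧
        p₁ ≠ p₃ ∧ p₂ ≠ p₃ ∧ ∀ p : Fin 4, p = p₀ ∨ p = p₁ ∨ p = p₂ ∨ p = p₃ := by decide
    exact key p₀
  obtain ⟨x₁, hx₁V, hx₁⟩ := hrep p₁ (hothers p₁ h10)
  obtain ⟨x₂, hx₂V, hx₂⟩ := hrep p₂ (hothers p₂ h20)
  obtain ⟨x₃, hx₃V, hx₃⟩ := hrep p₃ (hothers p₃ h30)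
  -- their top rows are pairwise perm-orthogonal: common support `{c}`
  obtain ⟨c, hc⟩ := common_support_of_perm_orth_three (ρ p₁ x₁) (ρ p₂ x₂) (ρ p₃ x₃) hx₁ hx₂ hx₃
    (fun l l' hll' => hP p₁ p₂ h12 _ ⟨x₁, hx₁V, rfl⟩ _ ⟨x₂, hx₂V, rfl⟩ l l' hll')
    (fun l l' hll' => hP p₁ p₃ h13 _ ⟨x₁, hx₁V, rfl⟩ _ ⟨x₃, hx₃V, rfl⟩ l l' hll')
    (fun l l' hll' => hP p₂ p₃ h23 _ ⟨x₂, hx₂V, rfl⟩ _ ⟨x₃, hx₃V, rfl⟩ l l' hll')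
  refine ⟨c, ?_⟩
  -- each representative lies in column `c`
  have hcol : ∀ (p : Fin 4) (x : Fin 4 × Fin 4 → K), x ∈ V p → (∀ l, l ≠ c → x (p, l) = 0) →
      x (p, c) ≠ 0 → ∀ i j, j ≠ c → x (i, j) = 0 := by
    intro p x hxV hpl hpc i j hjc
    obtain ⟨hxW, hxr⟩ := memV p x hxV
    by_cases hip : i = p
    · rw [hip]; exact hpl j hjc
    rcases lt_or_gt_of_ne hip with hlt | hgt
    · -- a row below the top: the `2 × 2` subpermanent with the top row
      have h := hB x hxW p i c j (Ne.symm hip) hjc.symm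
      rw [hpl j hjc, zero_mul, add_zero] at h
      exact (mul_eq_zero.1 h).resolve_left hpc
    · exact hxr i hgt j
  have rep_ne : ∀ (p : Fin 4) (x : Fin 4 × Fin 4 → K), ρ p x ≠ 0 → (∀ l, l ≠ c → x (p, l) = 0) →
      x (p, c) ≠ 0 := by
    intro p x hx hpl h
    apply hx
    funext l
    by_cases hl : l = c
    · rw [hl, hρ, h]; rfl
    · rw [hρ, hpl l hl]; rfl
  have hx₁c : ∀ l, l ≠ c → x₁ (p₁, l) = 0 := fun l hl => (hc l hl).1
  have hx₂c : ∀ l, l ≠ c → x₂ (p₂, l) = 0 := fun l hl => (hc l hl).2.1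
  have hx₃c : ∀ l, l ≠ c → x₃ (p₃, l) = 0 := fun l hl => (hc l hl).2.2
  have hc₁ := hcol p₁ x₁ hx₁V hx₁c (rep_ne p₁ x₁ hx₁ hx₁c)
  have hc₂ := hcol p₂ x₂ hx₂V hx₂c (rep_ne p₂ x₂ hx₂ hx₂c)
  have hc₃ := hcol p₃ x₃ hx₃V hx₃c (rep_ne p₃ x₃ hx₃ hx₃c)
  -- the three representatives span `W`
  have hW1 : x₁ ∈ W := (memV p₁ x₁ hx₁V).1
  have hW2 : x₂ ∈ W := (memV p₂ x₂ hx₂V).1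
  have hW3 : x₃ ∈ W := (memV p₃ x₃ hx₃V).1
  set C : Submodule K (Fin 4 × Fin 4 → K) := Submodule.span K {x₁, x₂, x₃} with hCdef
  have hCW : C ≤ W := by
    rw [hCdef, Submodule.span_le]
    intro x hx
    simp only [Set.mem_insert_iff, Set.mem_singleton_iff] at hx
    rcases hx with rfl | rfl | rfl
    · exact hW1
    · exact hW2
    · exact hW3
  -- linear independence through the distinct top rows
  have hli : LinearIndependent K ![x₁, x₂, x₃] := by
    rw [Fintype.linearIndependent_iff]
    intro g hg i
    have hg' : g 0 • x₁ + g 1 • x₂ + g 2 • x₃ = 0 := by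
      rw [Fin.sum_univ_three] at hg
      simpa using hg
    have top : ∀ (p : Fin 4) (t : K) (x y z : Fin 4 × Fin 4 → K), x ∈ V p → x (p, c) ≠ 0 →
        (∀ j, y (p, j) = 0) → (∀ j, z (p, j) = 0) → ∀ (s r : K), t • x + s • y + r • z = 0 →
        t = 0 := by
      intro p t x y z _ hxc hy hz s r h
      have := congr_fun h (p, c)
      simp only [Pi.add_apply, Pi.smul_apply, smul_eq_mul, hy c, hz c, mul_zero, add_zero,
        Pi.zero_apply] at this
      exact (mul_eq_zero.1 this).resolve_right hxc
    -- which of `p₁, p₂, p₃` is largest: eliminate in decreasing order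
    have zero_above : ∀ (p p' : Fin 4) (x : Fin 4 × Fin 4 → K), x ∈ V p → p < p' → ∀ j, x (p', j) = 0 :=
      fun p p' x hx hpp' j => (memV p x hx).2 p' hpp' j
    have hx₁c' := rep_ne p₁ x₁ hx₁ hx₁c
    have hx₂c' := rep_ne p₂ x₂ hx₂ hx₂c
    have hx₃c' := rep_ne p₃ x₃ hx₃ hx₃c
    -- case analysis on the order of `p₁, p₂, p₃`
    have aux : ∀ {a b : K} {y z : Fin 4 × Fin 4 → K} {pa pb : Fin 4}, y ∈ V pa → z ∈ V pb →
        y (pa, c) ≠ 0 → z (pb, c) ≠ 0 → pa ≠ pb → a • y + b • z = 0 → a = 0 ∧ b = 0 := by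
      intro a b y z pa pb hy hz hyc hzc hab h
      rcases lt_or_gt_of_ne hab with hlt | hgt
      · have hb : b = 0 := by
          have := congr_fun h (pb, c)
          simp only [Pi.add_apply, Pi.smul_apply, smul_eq_mul, zero_above pa pb y hy hlt c,
            mul_zero, zero_add, Pi.zero_apply] at this
          exact (mul_eq_zero.1 this).resolve_right hzc
        subst hb
        have := congr_fun h (pa, c)
        simp only [Pi.add_apply, Pi.smul_apply, smul_eq_mul, zero_mul, add_zero,
          Pi.zero_apply] at this
        exact ⟨(mul_eq_zero.1 this).resolve_right hyc, rfl⟩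
      · have ha : a = 0 := by
          have := congr_fun h (pa, c)
          simp only [Pi.add_apply, Pi.smul_apply, smul_eq_mul, zero_above pb pa z hz hgt c,
            mul_zero, add_zero, Pi.zero_apply] at this
          exact (mul_eq_zero.1 this).resolve_right hyc
        subst ha
        have := congr_fun h (pb, c)
        simp only [Pi.add_apply, Pi.smul_apply, smul_eq_mul, zero_mul, zero_add,
          Pi.zero_apply] at this
        exact ⟨rfl, (mul_eq_zero.1 this).resolve_right hzc⟩
    -- the largest of the three indices has coefficient `0`, then the other two by `aux`
    have hmax : ∀ (a b d : K) (y z w : Fin 4 × Fin 4 → K) (pa pb pd : Fin 4),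
        y ∈ V pa → z ∈ V pb → w ∈ V pd → y (pa, c) ≠ 0 → z (pb, c) ≠ 0 → w (pd, c) ≠ 0 →
        pa ≠ pb → pa ≠ pd → pb ≠ pd → pa < pd → pb < pd →
        a • y + b • z + d • w = 0 → a = 0 ∧ b = 0 ∧ d = 0 := by
      intro a b d y z w pa pb pd hy hz hw' hyc hzc hwc hab _ _ had hbd h
      have hd : d = 0 := by
        have := congr_fun h (pd, c)
        simp only [Pi.add_apply, Pi.smul_apply, smul_eq_mul, zero_above pa pd y hy had c,
          zero_above pb pd z hz hbd c, mul_zero, zero_add, Pi.zero_apply] at this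
        exact (mul_eq_zero.1 this).resolve_right hwc
      subst hd
      rw [zero_smul, add_zero] at h
      obtain ⟨ha, hb⟩ := aux hy hz hyc hzc hab h
      exact ⟨ha, hb, rfl⟩
    -- dispatch on which index is the largest
    rcases lt_trichotomy p₁ p₂ with h12' | h12' | h12'
    · rcases lt_or_gt_of_ne h23 with h23' | h23'
      · -- p₃ largest
        obtain ⟨a, b, d⟩ := hmax (g 0) (g 1) (g 2) x₁ x₂ x₃ p₁ p₂ p₃ hx₁V hx₂V hx₃V hx₁c' hx₂c'
          hx₃c' h12 h13 h23 (h12'.trans h23') h23' hg'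
        fin_cases i
        · exact a
        · exact b
        · exact d
      · -- p₂ largest
        have hg'' : g 0 • x₁ + g 2 • x₃ + g 1 • x₂ = 0 := by rw [← hg']; abel
        obtain ⟨a, d, b⟩ := hmax (g 0) (g 2) (g 1) x₁ x₃ x₂ p₁ p₃ p₂ hx₁V hx₃V hx₂V hx₁c' hx₃c'
          hx₂c' h13 h12 h23.symm h12' h23' hg''
        fin_cases i
        · exact a
        · exact b
        · exact d
    · exact absurd h12' h12
    · rcases lt_or_gt_of_ne h13 with h13' | h13'
      · -- p₃ largest
        obtain ⟨a, b, d⟩ := hmax (g 0) (g 1) (g 2) x₁ x₂ x₃ p₁ p₂ p₃ hx₁V hx₂V hx₃V hx₁c' hx₂c'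
          hx₃c' h12 h13 h23 h13' (h12'.trans h13') hg'
        fin_cases i
        · exact a
        · exact b
        · exact d
      · -- p₁ largest
        have hg'' : g 1 • x₂ + g 2 • x₃ + g 0 • x₁ = 0 := by rw [← hg']; abel
        obtain ⟨b, d, a⟩ := hmax (g 1) (g 2) (g 0) x₂ x₃ x₁ p₂ p₃ p₁ hx₂V hx₃V hx₁V hx₂c' hx₃c'
          hx₁c' h23 h12.symm h13.symm h12' h13' hg''
        fin_cases i
        · exact a
        · exact b
        · exact d
  have hCdim : finrank K C = 3 := by
    rw [hCdef]
    have h := finrank_span_eq_card hli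
    simp only [Fintype.card_fin] at h
    have hrange : Set.range ![x₁, x₂, x₃] = {x₁, x₂, x₃} := by
      ext y
      simp only [Set.mem_range, Set.mem_insert_iff, Set.mem_singleton_iff]
      constructor
      · rintro ⟨i, rfl⟩; fin_cases i <;> simp
      · rintro (rfl | rfl | rfl)
        · exact ⟨0, rfl⟩
        · exact ⟨1, rfl⟩
        · exact ⟨2, rfl⟩
    rw [← hrange]; exact h
  have hCeq : C = W := Submodule.eq_of_le_of_finrank_le hCW (by rw [hCdim, h3])
  intro x hx i j hjc
  rw [← hCeq, hCdef, Submodule.mem_span_insert] at hx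
  obtain ⟨a, y, hy, rfl⟩ := hx
  rw [Submodule.mem_span_pair] at hy
  obtain ⟨b, d, rfl⟩ := hy
  simp only [Pi.add_apply, Pi.smul_apply, smul_eq_mul, hc₁ i j hjc, hc₂ i j hjc, hc₃ i j hjc,
    mul_zero, add_zero]

end Summit.ValiantsHypothesis.ValiantsHypothesis.Theorems.SymPencilPerFourBlocksThree

end
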